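import Summits.HodgeConjecture.CorCM.PairFlipCompanionSplitOff
import Summits.HodgeConjecture.CorCM.PairFlipIsomorphicFieldsFamilies
import HarnessLib

/-!
# Products of arbitrarily many generic CM abelian varieties of one dimension over one totally real field: nondegenerate
# as soon as no isomorphism class of fields is used more than three times

COR-CM (cell `pub-hodgecm2`, binder seat `b16` gen 51, count-neutral claim PAIRFLIP-COMPANION, file F8 — abelian
varieties; theorems only, no definition, no named fact, no `sorry`).  NEW as stated, hence under `Summits/`.  HONEST
FRAMING: unconditional theorems on products of CM abelian varieties; `HC_CM` is neither used nor asserted.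

F7 (`PairFlipCompanionSplitOff`) asked the generic fields to be pairwise NON-ISOMORPHIC.  Isomorphic fields are allowed
here: the family is fibred along the ISOMORPHISM CLASS of the field (`isNondegenerateFamily_of_fibers`); across classes
F2 (`pairwise_of_pairFlip_compatible` with `pairFlip_compatible_of_ringHom_real`) excludes common constituents, and inside
a class seat p2's three-classes theorem transported (`isNondegenerateFamily_of_ringEquiv_of_pairFlip_of_card_le_three`,
b16 gen 43) applies: any two or three pairwise non-isogenous CM abelian varieties with ISOMORPHIC generic CM fields are
independent (while more than `n = [K:ℚ]/2` never are).

* **`isNondegenerateFamily_pairFlip_of_ringHom_real_of_card_le_three`** — all `K_i ⊇ e_i(F)` generic (pair flips) of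
  degree `2[F:ℚ]` over the totally real `F`, realisations pairwise non-isogenous, at most three slots in each isomorphism
  class of fields ⟹ `(Φ_i)_i` nondegenerate (`Hg(∏ A_i) = ∏ Hg(A_i)`, full rank).
* **`hodgeConjectureFor_prod_pairFlip_of_ringHom_real_of_card_le_three`** — then the Hodge conjecture with `B• = D•` on
  every `⨁_{j<N} A_{π j}`, UNCONDITIONALLY; `not_exists_exceptional_prod_…`.
* `not_isNondegenerateFamily_of_lt_card_ringEquiv` — conversely a class with more than `[F:ℚ]` members makes the family
  degenerate (seat p2's bound, transported; recorded for the census).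

E.g. generic sextic fields over one real cubic field: ANY number of pairwise non-isogenous simple CM threefolds, at most
three per field; generic octic fields over one real quartic field: at most three simple CM fourfolds per field (four per
field is the first undecided count here: `n = 4` types of one octic field may or may not be independent).

## References

* [Gordon1999HodgeAVSurvey] B. B. Gordon, *A survey of the Hodge conjecture for abelian varieties*, §3 Theorem, 7.4–7.7,
  10.10.
* [Dodson1984] B. Dodson, *The structure of Galois groups of CM-fields*, Trans. AMS 283 (1984), §1.1, §5.1.2.
* [MoonenZarhin1999LowDim] B. Moonen, Yu. Zarhin, *Hodge classes on abelian varieties of low dimension*, Math. Ann. 315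
  (1999), §3 (3.1).
-/

noncomputable section

open CategoryTheory CategoryTheory.Limits NumberField Module IntermediateField

namespace Summit.HodgeConjecture.CorCM

open Literature.NumberTheory.ComplexMultiplication
open Literature.AlgebraicGeometry.Motives (AbelianVariety CMType)
open Literature.AlgebraicGeometry.HodgeTheory
open Literature.AlgebraicGeometry.ComplexMultiplication (IsCMTypeRealisation isSimple_iff_isPrimitive)
open Literature.AlgebraicGeometry.VanGeemen1994 (hodgeClassSpan)
open Literature.AlgebraicGeometry.Pohlmann1968
open Literature.Barriers.HodgeConjecture (divisorClassesSpan)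

variable {I : Type} {K : I → Type} [∀ i, Field (K i)] [∀ i, NumberField (K i)] [∀ i, IsCMField (K i)] [Fintype I]
  [DecidableEq I] [Nonempty I] {Φ : ∀ i, CMType (K i)} {F : Type} [Field F] [NumberField F] [IsTotallyReal F]
  {A : I → AbelianVariety ℂ} {ι : ∀ i, 𝓞 (K i) →+* End (A i)} {θ : ∀ i, K i →+* Module.End ℂ (complexBetti (A i).X 1)}

open scoped Classical in
/-- **Generic CM fields over one totally real field, at most three non-isogenous varieties per field: nondegenerate.**
All `K_i ⊇ e_i(F)` with pair flips and `[K_i:ℚ] = 2[F:ℚ]`, realisations `A_i` pairwise non-isogenous, and every isomorphism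
class of fields met by at most three slots ⟹ `Hg(∏ A_i) = ∏ Hg(A_i)` with all factors of full rank.
[cite: Gordon1999HodgeAVSurvey, §3 Theorem and 7.4–7.7] [cite: MoonenZarhin1999LowDim, §3 (3.1)] [cite: Dodson1984, §5.1.2] -/
theorem isNondegenerateFamily_pairFlip_of_ringHom_real_of_card_le_three
    (hflip : ∀ i, ∀ s : K i →+* ℂ, ∃ σ : ℂ ≃+* ℂ, σ • s = (starRingAut : ℂ ≃+* ℂ) • s ∧
      ∀ t : K i →+* ℂ, t ≠ s → t ≠ (starRingAut : ℂ ≃+* ℂ) • s → σ • t = t)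
    (e : ∀ i, F →+* K i) (hF : ∀ i, finrank ℚ (K i) = 2 * finrank ℚ F)
    (hA : ∀ i, IsCMTypeRealisation (Φ i) (A i) (ι i) (θ i))
    (hniso : ∀ i j, i ≠ j → ¬ AbelianVariety.IsIsogenous (A i) (A j))
    (htri : ∀ i, (Finset.univ.filter fun j => Nonempty (K j ≃+* K i)).card ≤ 3) :
    CMAlgebra.IsNondegenerateFamily Φ := by
  classical
  refine isNondegenerateFamily_of_fibers Φ (fun i => Finset.univ.filter fun j : I => Nonempty (K j ≃+* K i))
    (fun i j hij => ?_) (fun c hc => ?_)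
  · -- different isomorphism classes: no common constituent (F2)
    have hne : IsEmpty (K i ≃+* K j) := ⟨fun f => hij (by
      ext j'
      simp only [Finset.mem_filter, Finset.mem_univ, true_and]
      exact ⟨fun ⟨g⟩ => ⟨g.trans f⟩, fun ⟨g⟩ => ⟨g.trans f.symm⟩⟩)⟩
    have hij' : i ≠ j := by rintro rfl; exact hne.false (RingEquiv.refl _)
    exact (pairwise_of_pairFlip_compatible (Φ := Φ)
      (pairFlip_compatible_of_ringHom_real (Φ i) (hflip i) (e i) (e j) (hF j)) ((hF i).trans (hF j).symm) hne).1
  · -- one isomorphism class: at most three members, seat p2's theorem transported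
    obtain ⟨j₀, hj₀⟩ := hc
    have hiso : ∀ j : {j // (Finset.univ.filter fun j' : I => Nonempty (K j' ≃+* K j)) = c}, Nonempty (K j.1 ≃+* K j₀) :=
      fun j => by
        have h1 : j.1 ∈ c := (Finset.ext_iff.1 j.2 j.1).1 (Finset.mem_filter.2 ⟨Finset.mem_univ _, ⟨RingEquiv.refl _⟩⟩)
        have h2 : j.1 ∈ (Finset.univ.filter fun j' : I => Nonempty (K j' ≃+* K j₀)) := (Finset.ext_iff.1 hj₀ j.1).2 h1
        exact (Finset.mem_filter.1 h2).2
    let e' : ∀ j : {j // (Finset.univ.filter fun j' : I => Nonempty (K j' ≃+* K j)) = c}, K j.1 ≃+* K j₀ :=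
      fun j => Classical.choice (hiso j)
    haveI : Nonempty {j // (Finset.univ.filter fun j' : I => Nonempty (K j' ≃+* K j)) = c} := ⟨⟨j₀, hj₀⟩⟩
    refine isNondegenerateFamily_of_ringEquiv_of_pairFlip_of_card_le_three
      (K := fun j : {j // (Finset.univ.filter fun j' : I => Nonempty (K j' ≃+* K j)) = c} => K j.1)
      e' (hflip j₀) (fun j => hA j.1) (fun a b hab => hniso a.1 b.1 fun h => hab (Subtype.ext h)) ?_
    calc Fintype.card {j // (Finset.univ.filter fun j' : I => Nonempty (K j' ≃+* K j)) = c}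
        ≤ (Finset.univ.filter fun j' : I => Nonempty (K j' ≃+* K j₀)).card := by
          rw [← Fintype.card_coe]
          refine Fintype.card_le_of_injective (fun j => ⟨j.1, Finset.mem_filter.2 ⟨Finset.mem_univ _, hiso j⟩⟩)
            fun a b hab => Subtype.ext (congrArg (fun x : ↥(Finset.univ.filter fun j' : I =>
              Nonempty (K j' ≃+* K j₀)) => (x : I)) hab)
      _ ≤ 3 := htri j₀

open scoped Classical in
/-- **The Hodge conjecture on every product** of pairwise non-isogenous CM abelian varieties of one dimension whose CM fields
are generic over one totally real field, at most three per isomorphism class of fields — with `B• = D•` on every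
`⨁_{j<N} A_{π j}`, UNCONDITIONALLY. [cite: Gordon1999HodgeAVSurvey, 7.5 and 10.10] -/
theorem hodgeConjectureFor_prod_pairFlip_of_ringHom_real_of_card_le_three
    (hflip : ∀ i, ∀ s : K i →+* ℂ, ∃ σ : ℂ ≃+* ℂ, σ • s = (starRingAut : ℂ ≃+* ℂ) • s ∧
      ∀ t : K i →+* ℂ, t ≠ s → t ≠ (starRingAut : ℂ ≃+* ℂ) • s → σ • t = t)
    (e : ∀ i, F →+* K i) (hF : ∀ i, finrank ℚ (K i) = 2 * finrank ℚ F)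
    (hA : ∀ i, IsCMTypeRealisation (Φ i) (A i) (ι i) (θ i))
    (hniso : ∀ i j, i ≠ j → ¬ AbelianVariety.IsIsogenous (A i) (A j))
    (htri : ∀ i, (Finset.univ.filter fun j => Nonempty (K j ≃+* K i)).card ≤ 3) {N : ℕ} (π : Fin N → I) :
    HodgeConjectureFor (⨁ fun j : Fin N => A (π j)).dim (⨁ fun j : Fin N => A (π j)).X ∧
      ∀ m : ℕ, hodgeClassSpan (⨁ fun j : Fin N => A (π j)).dim (⨁ fun j : Fin N => A (π j)).X m =
        divisorClassesSpan (⨁ fun j : Fin N => A (π j)).X (⨁ fun j : Fin N => A (π j)).dim m :=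
  have h := isNondegenerateFamily_pairFlip_of_ringHom_real_of_card_le_three (Φ := Φ) hflip e hF hA hniso htri
  ⟨h.hodgeConjectureFor_prod hA π, fun m => h.hodgeClassSpan_prod_eq_divisorClassesSpan hA π m⟩

open scoped Classical in
/-- **No exceptional Hodge class on any product** under the same hypotheses. [cite: Gordon1999HodgeAVSurvey, 7.5 (1) ⟹ (3)] -/
theorem not_exists_exceptional_prod_pairFlip_of_ringHom_real_of_card_le_three
    (hflip : ∀ i, ∀ s : K i →+* ℂ, ∃ σ : ℂ ≃+* ℂ, σ • s = (starRingAut : ℂ ≃+* ℂ) • s ∧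
      ∀ t : K i →+* ℂ, t ≠ s → t ≠ (starRingAut : ℂ ≃+* ℂ) • s → σ • t = t)
    (e : ∀ i, F →+* K i) (hF : ∀ i, finrank ℚ (K i) = 2 * finrank ℚ F)
    (hA : ∀ i, IsCMTypeRealisation (Φ i) (A i) (ι i) (θ i))
    (hniso : ∀ i j, i ≠ j → ¬ AbelianVariety.IsIsogenous (A i) (A j))
    (htri : ∀ i, (Finset.univ.filter fun j => Nonempty (K j ≃+* K i)).card ≤ 3) :
    ¬ ∃ (N : ℕ) (π : Fin N → I) (m : ℕ) (c : complexBetti (⨁ fun j : Fin N => A (π j)).X (2 * m)),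
      IsRationalClass c ∧
      IsOfHodgeType (⨁ fun j : Fin N => A (π j)).dim (⨁ fun j : Fin N => A (π j)).X (2 * m) m m c ∧
      c ∉ divisorClassesSpan (⨁ fun j : Fin N => A (π j)).X (⨁ fun j : Fin N => A (π j)).dim m := by
  rintro ⟨N, π, m, c, hcQ, hcH, hcD⟩
  have h := isNondegenerateFamily_pairFlip_of_ringHom_real_of_card_le_three (Φ := Φ) hflip e hF hA hniso htri
  exact hcD (by
    rw [← h.hodgeClassSpan_prod_eq_divisorClassesSpan hA π m]
    exact Submodule.subset_span ⟨hcQ, hcH⟩)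

open scoped Classical in
omit [DecidableEq I] [Nonempty I] [IsTotallyReal F] in
/-- **More than `[F:ℚ]` slots with fields isomorphic to one `K_{i₀}` of degree `2[F:ℚ]`: the family is degenerate** (at most
`n` pairwise inequivalent types of a CM field of degree `2n` are jointly nondegenerate, and a sub-family of a nondegenerate
family is nondegenerate). [cite: Gordon1999HodgeAVSurvey, 7.5–7.7 and 7.6.1] -/
theorem not_isNondegenerateFamily_of_lt_card_ringEquiv (i₀ : I) (hF : finrank ℚ (K i₀) = 2 * finrank ℚ F)
    (hlt : finrank ℚ F < (Finset.univ.filter fun j => Nonempty (K j ≃+* K i₀)).card) :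
    ¬ CMAlgebra.IsNondegenerateFamily Φ := by
  classical
  intro hΦ
  have hsub := isNondegenerateFamily_subtype hΦ (fun j => Nonempty (K j ≃+* K i₀)) ⟨i₀, ⟨RingEquiv.refl _⟩⟩
  haveI : Nonempty {j // Nonempty (K j ≃+* K i₀)} := ⟨⟨i₀, ⟨RingEquiv.refl _⟩⟩⟩
  refine not_isNondegenerateFamily_of_ringEquiv_of_lt_card (K := fun j : {j // Nonempty (K j ≃+* K i₀)} => K j.1)
    (fun j => Classical.choice j.2) (fun j => Φ j.1) ?_ hsub
  rw [hF, Nat.mul_div_cancel_left _ two_pos, Fintype.card_subtype]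
  exact hlt

end Summit.HodgeConjecture.CorCM

end
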